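import Mathlib
import HarnessLib

/-!
# Crux `NarrowRunsDie` (stmt-ResolutionOfSingularities-16882, route `WildCones`), line `derivlift` —
# stub `stub_freeEndgame`

Registered stub of the line skeleton `Cruxes/NarrowRunsDie/Lines/derivlift.lean` (v3), stated over the
route's inlined `let` calculus VERBATIM. See the skeleton docstring of `Sig.stub_freeEndgame` for the paper proof.

Proof outline (all over `R = κ⟦u_1..u_n⟧ = MvPowerSeries (Fin n) κ`):
1. (nilpotency) `R ⧸ J` is module-finite over the field `κ`, hence Artinian, so the chain of
   principal ideals `(x̄^k)` of `x̄ := mk (X (i 0))` stabilises: `x̄^(D+1) ȳ = x̄^D`, i.e.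
   `X^D (X y - 1) ∈ J` with `X y - 1` a unit of `R` (constant coefficient `-1`), so
   `X (i 0)^D ∈ J`;
2. (transport) `J` is spanned by the partials `g l` and `Phi m` is a ring endomorphism, so
   multiplying `Phi m (X (i 0)^D) = ∑ Phi m (r l) * Phi m (g l)` by `piE m` and using the
   divisibility hypothesis gives `piE m * Phi m (X (i 0))^D = piE m ^ p * H`;
3. (freeness) by induction, `piE (m+1) = X (i m)^(m+1) * U` and `Phi (m+1) (X (i 0)) = X (i m) * V`
   with `U`, `V` of nonzero constant coefficient (this is where the word being FREE is used);
4. (contradiction) at `m + 1 = D + 1` compare the coefficients of `u_{i D}^{(D+1)+D}` on both sides: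
   nonzero on the left, zero on the right since `(D+1) p ≥ 2 (D+1) > (D+1) + D`.
-/

noncomputable section

set_option linter.dupNamespace false

namespace Summit.ResolutionOfSingularities.ResolutionOfSingularities.Theorems.NarrowRunsDie

open MvPowerSeries

section EndgameHelpers

variable {n : ℕ} {κ : Type} [Field κ]

/-- The members `X i` / `X i * b` of the substitution family have zero constant coefficient
(stated with the `ite` shape of the verbatim `let`, for any decidability witness). -/
theorem endgame_ite_constantCoeff (i j : Fin n) (d : Decidable (j = i))
    (b : MvPowerSeries (Fin n) κ) :
    constantCoeff (@ite (MvPowerSeries (Fin n) κ) (j = i) d (X i) (X i * b)) = 0 := by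
  split <;> simp

/-- The substitution family of the chart map `sub i τ` (the verbatim `let` text: `X i ↦ X i`,
`X j ↦ X i * (X j + C (τ j))` for `j ≠ i`) `HasSubst`, so `sub i τ` is a `κ`-algebra
endomorphism. -/
theorem endgame_fam_hasSubst (i : Fin n) (τ : Fin n → κ) :
    HasSubst (fun j : Fin n => @ite (MvPowerSeries (Fin n) κ) (j = i) (Classical.dec _)
      (MvPowerSeries.X i) (MvPowerSeries.X i * (MvPowerSeries.X j + MvPowerSeries.C (τ j)))) :=
  hasSubst_of_constantCoeff_zero (fun j => endgame_ite_constantCoeff i j _ _)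

/-- Nilpotency step: if `R ⧸ J` is module-finite over `κ` then some power of every variable lies
in `J` (Artinian stabilisation of the principal ideals `(x̄^k)` plus `X y - 1` being a unit). -/
theorem endgame_exists_X_pow_mem (J : Ideal (MvPowerSeries (Fin n) κ))
    (hJ : Module.Finite κ (MvPowerSeries (Fin n) κ ⧸ J)) (s : Fin n) :
    ∃ D : ℕ, (X s : MvPowerSeries (Fin n) κ) ^ D ∈ J := by
  haveI := hJ
  haveI : IsArtinianRing (MvPowerSeries (Fin n) κ ⧸ J) := IsArtinianRing.of_finite κ _
  obtain ⟨D, y, hy⟩ :=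
    IsArtinian.exists_pow_succ_smul_dvd (Ideal.Quotient.mk J (X s))
      (1 : MvPowerSeries (Fin n) κ ⧸ J)
  obtain ⟨y, rfl⟩ := Ideal.Quotient.mk_surjective y
  refine ⟨D, ?_⟩
  simp only [smul_eq_mul, mul_one, Nat.succ_eq_add_one] at hy
  have h1 : Ideal.Quotient.mk J (X s ^ D * (X s * y - 1)) = 0 := by
    have : Ideal.Quotient.mk J (X s ^ D * (X s * y - 1)) =
        Ideal.Quotient.mk J (X s) ^ (D + 1) * Ideal.Quotient.mk J y -
          Ideal.Quotient.mk J (X s) ^ D := by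
      simp only [map_mul, map_sub, map_one, map_pow]; ring
    rw [this, hy, sub_self]
  rw [Ideal.Quotient.eq_zero_iff_mem] at h1
  have hu : IsUnit (X s * y - 1 : MvPowerSeries (Fin n) κ) := by
    rw [MvPowerSeries.isUnit_iff_constantCoeff]; simp
  obtain ⟨u, hu⟩ := hu
  have : (X s : MvPowerSeries (Fin n) κ) ^ D =
      X s ^ D * (X s * y - 1) *
        ((u⁻¹ : (MvPowerSeries (Fin n) κ)ˣ) : MvPowerSeries (Fin n) κ) := by
    rw [← hu, Units.mul_inv_cancel_right]
  rw [this]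
  exact J.mul_mem_right _ h1

variable (sub : Fin n → (Fin n → κ) → MvPowerSeries (Fin n) κ → MvPowerSeries (Fin n) κ)
  (hsub : ∀ (i : Fin n) (τ : Fin n → κ) (f : MvPowerSeries (Fin n) κ), sub i τ f =
    MvPowerSeries.subst (fun j : Fin n => @ite (MvPowerSeries (Fin n) κ) (j = i) (Classical.dec _)
      (MvPowerSeries.X i) (MvPowerSeries.X i * (MvPowerSeries.X j + MvPowerSeries.C (τ j)))) f)

include hsub

/-- `sub i τ` fixes the exceptional variable `X i`. -/
theorem endgame_sub_X_self (i : Fin n) (τ : Fin n → κ) :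
    sub i τ (X i) = X i := by
  rw [hsub, subst_X (endgame_fam_hasSubst i τ)]; simp

/-- `sub i τ` sends `X j ↦ X i * (X j + C (τ j))` for `j ≠ i`. -/
theorem endgame_sub_X_ne (i j : Fin n) (τ : Fin n → κ) (h : j ≠ i) :
    sub i τ (X j) = X i * (X j + C (τ j)) := by
  rw [hsub, subst_X (endgame_fam_hasSubst i τ)]; simp [h]

/-- `sub i τ` is (the underlying function of) a `κ`-algebra endomorphism of `R`. -/
theorem endgame_sub_algHom (i : Fin n) (τ : Fin n → κ) :
    ∃ ψ : MvPowerSeries (Fin n) κ →ₐ[κ] MvPowerSeries (Fin n) κ,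
      ∀ f, sub i τ f = ψ f :=
  ⟨substAlgHom (endgame_fam_hasSubst i τ), fun f => by rw [hsub, substAlgHom_apply]⟩

/-- `sub i τ` preserves constant coefficients (all members of the family have constant
coefficient `0`). -/
theorem endgame_constantCoeff_sub (i : Fin n) (τ : Fin n → κ) (f : MvPowerSeries (Fin n) κ) :
    constantCoeff (sub i τ f) = constantCoeff f := by
  obtain ⟨c, g, hg, rfl⟩ : ∃ (c : κ) (g : MvPowerSeries (Fin n) κ),
      constantCoeff g = 0 ∧ f = C c + g :=
    ⟨constantCoeff f, f - C (constantCoeff f), by simp, by ring⟩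
  rw [hsub, subst_add (endgame_fam_hasSubst i τ), subst_C, map_add, map_add,
    constantCoeff_subst_eq_zero (endgame_fam_hasSubst i τ)
      (fun j => endgame_ite_constantCoeff i j _ _) hg, hg, constantCoeff_C]

variable (i : ℕ → Fin n) (t : ℕ → Fin n → κ)
  (Phi : ℕ → MvPowerSeries (Fin n) κ → MvPowerSeries (Fin n) κ)
  (piE : ℕ → MvPowerSeries (Fin n) κ)

/-- Transport step: each composite chart map `Phi m` is (the underlying function of) a ring
endomorphism of `R`. -/
theorem endgame_Phi_hom
    (hPhi0 : ∀ f, Phi 0 f = f) (hPhiS : ∀ m f, Phi (m + 1) f = sub (i m) (t m) (Phi m f))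
    (m : ℕ) :
    ∃ φ : MvPowerSeries (Fin n) κ →+* MvPowerSeries (Fin n) κ, ∀ f, Phi m f = φ f := by
  induction m with
  | zero => exact ⟨RingHom.id _, fun f => by rw [hPhi0]; rfl⟩
  | succ m ih =>
    obtain ⟨φ, hφ⟩ := ih
    obtain ⟨ψ, hψ⟩ := endgame_sub_algHom sub hsub (i m) (t m)
    exact ⟨ψ.toRingHom.comp φ, fun f => by rw [hPhiS, hφ, hψ]; rfl⟩

/-- Freeness step: along a FREE word the exceptional monomial is a unit multiple of a pure power of
the current exceptional variable, `piE (m+1) = X (i m)^(m+1) * U`, and the transform of the first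
exceptional variable is a unit multiple of the current one, `Phi (m+1) (X (i 0)) = X (i m) * V`. -/
theorem endgame_free_shape
    (hPhi0 : ∀ f, Phi 0 f = f) (hPhiS : ∀ m f, Phi (m + 1) f = sub (i m) (t m) (Phi m f))
    (hpiE0 : piE 0 = 1) (hpiES : ∀ m, piE (m + 1) = X (i m) * sub (i m) (t m) (piE m))
    (hfree : ∀ m, i (m + 1) = i m ∨ t (m + 1) (i m) ≠ 0) (m : ℕ) :
    ∃ U V : MvPowerSeries (Fin n) κ, constantCoeff U ≠ 0 ∧ constantCoeff V ≠ 0 ∧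
      piE (m + 1) = X (i m) ^ (m + 1) * U ∧ Phi (m + 1) (X (i 0)) = X (i m) * V := by
  induction m with
  | zero =>
    obtain ⟨ψ, hψ⟩ := endgame_sub_algHom sub hsub (i 0) (t 0)
    refine ⟨1, 1, by simp, by simp, ?_, ?_⟩
    · rw [hpiES, hpiE0, hψ, map_one]; ring
    · rw [hPhiS, hPhi0, endgame_sub_X_self sub hsub]; ring
  | succ m ih =>
    obtain ⟨U, V, hU, hV, hpi, hPhi⟩ := ih
    obtain ⟨ψ, hψ⟩ := endgame_sub_algHom sub hsub (i (m + 1)) (t (m + 1))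
    have hcc : ∀ f, constantCoeff (ψ f) = constantCoeff f := fun f => by
      rw [← hψ, endgame_constantCoeff_sub sub hsub]
    obtain ⟨W, hW, hWeq⟩ : ∃ W : MvPowerSeries (Fin n) κ, constantCoeff W ≠ 0 ∧
        ψ (X (i m)) = X (i (m + 1)) * W := by
      by_cases h : i (m + 1) = i m
      · refine ⟨1, by simp, ?_⟩
        rw [← hψ, ← h, endgame_sub_X_self sub hsub, mul_one]
      · have ht : t (m + 1) (i m) ≠ 0 := (hfree m).resolve_left h
        refine ⟨X (i m) + C (t (m + 1) (i m)), by simpa using ht, ?_⟩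
        rw [← hψ]
        exact endgame_sub_X_ne sub hsub (i (m + 1)) (i m) (t (m + 1)) (Ne.symm h)
    refine ⟨W ^ (m + 1) * ψ U, W * ψ V, ?_, ?_, ?_, ?_⟩
    · rw [map_mul, map_pow, hcc]
      exact mul_ne_zero (pow_ne_zero _ hW) hU
    · rw [map_mul, hcc]
      exact mul_ne_zero hW hV
    · rw [hpiES, hpi, hψ, map_mul, map_pow, hWeq]; ring
    · rw [hPhiS, hPhi, hψ, map_mul, hWeq]; ring

/-- The endgame over an abstract family of partials `g` spanning `J`: isolated start + FREE word +
divisibility of `piE m * Phi m (g l)` by `piE m ^ p` for all `m`, `l` is contradictory. -/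
theorem endgame_main (p : ℕ) (hp : 2 ≤ p) (g : Fin n → MvPowerSeries (Fin n) κ)
    (hPhi0 : ∀ f, Phi 0 f = f) (hPhiS : ∀ m f, Phi (m + 1) f = sub (i m) (t m) (Phi m f))
    (hpiE0 : piE 0 = 1) (hpiES : ∀ m, piE (m + 1) = X (i m) * sub (i m) (t m) (piE m))
    (hIsol : Module.Finite κ (MvPowerSeries (Fin n) κ ⧸ Ideal.span (Set.range g)))
    (hfree : ∀ m, i (m + 1) = i m ∨ t (m + 1) (i m) ≠ 0)
    (hdiv : ∀ (m : ℕ) (l : Fin n), ∃ h' : MvPowerSeries (Fin n) κ,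
        piE m * Phi m (g l) = piE m ^ p * h') : False := by
  classical
  obtain ⟨D, hD⟩ := endgame_exists_X_pow_mem (Ideal.span (Set.range g)) hIsol (i 0)
  obtain ⟨r, hr⟩ := Ideal.mem_span_range_iff_exists_fun.mp hD
  obtain ⟨U, V, hU, hV, hpi, hPhi⟩ :=
    endgame_free_shape sub hsub i t Phi piE hPhi0 hPhiS hpiE0 hpiES hfree D
  obtain ⟨φ, hφ⟩ := endgame_Phi_hom sub hsub i t Phi hPhi0 hPhiS (D + 1)
  choose h' hh' using hdiv (D + 1)
  have key : piE (D + 1) * Phi (D + 1) (X (i 0)) ^ D =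
      piE (D + 1) ^ p * ∑ l, φ (r l) * h' l := by
    have hsum : Phi (D + 1) (X (i 0)) ^ D = ∑ l, φ (r l) * Phi (D + 1) (g l) := by
      simp only [hφ]
      rw [← map_pow, ← hr, map_sum]
      simp only [map_mul]
    rw [hsum, Finset.mul_sum, Finset.mul_sum]
    refine Finset.sum_congr rfl fun l _ => ?_
    rw [mul_left_comm, hh' l]; ring
  rw [hpi, hPhi] at key
  have lhs : coeff (Finsupp.single (i D) (D + 1 + D)) (X (i D) ^ (D + 1) * U * (X (i D) * V) ^ D) =
      constantCoeff U * constantCoeff V ^ D := by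
    have : X (i D) ^ (D + 1) * U * (X (i D) * V) ^ D =
        monomial (Finsupp.single (i D) (D + 1 + D)) (1 : κ) * (U * V ^ D) := by
      rw [← X_pow_eq]; ring
    rw [this, coeff_monomial_mul, if_pos le_rfl, tsub_self, one_mul,
      coeff_zero_eq_constantCoeff_apply, map_mul, map_pow]
  have rhs : coeff (Finsupp.single (i D) (D + 1 + D))
      ((X (i D) ^ (D + 1) * U) ^ p * ∑ l, φ (r l) * h' l) = 0 := by
    have hdvd : (X (i D) : MvPowerSeries (Fin n) κ) ^ ((D + 1) * p) ∣
        (X (i D) ^ (D + 1) * U) ^ p * ∑ l, φ (r l) * h' l :=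
      ⟨U ^ p * ∑ l, φ (r l) * h' l, by rw [pow_mul]; ring⟩
    rw [X_pow_dvd_iff] at hdvd
    apply hdvd
    simp only [Finsupp.single_eq_same]
    calc D + 1 + D < (D + 1) * 2 := by omega
      _ ≤ (D + 1) * p := Nat.mul_le_mul_left _ hp
  rw [key, rhs] at lhs
  exact mul_ne_zero hU (pow_ne_zero _ hV) lhs.symm

end EndgameHelpers

/-- Stub `stub_freeEndgame` of line `derivlift` for crux `WildCones.NarrowRunsDie` (registered signature, verbatim). -/
theorem stub_freeEndgame :
  ∀ p : ℕ, p.Prime → ∀ n : ℕ, 0 < n → ∀ (κ : Type) [Field κ] [CharP κ p] [PerfectField κ]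
    (c₀ : (Fin n → ℕ) → κ) (i : ℕ → Fin n) (t : ℕ → Fin n → κ),
    let clean : ((Fin n → ℕ) → κ) → ((Fin n → ℕ) → κ) := fun c A => @ite κ (∀ j, p ∣ A j) (Classical.dec _) 0 (c A);
    let bl : Fin n → ((Fin n → ℕ) → κ) → ((Fin n → ℕ) → κ) := fun i c B => @ite κ (Finset.sum (Finset.univ.erase i) (fun j => B j) ≤ B i) (Classical.dec _) (c (Function.update B i (B i - Finset.sum (Finset.univ.erase i) (fun j => B j)))) 0;
    let ord : ((Fin n → ℕ) → κ) → ℕ := fun c => sInf {m : ℕ | ∃ A, c A ≠ 0 ∧ m = Finset.sum Finset.univ (fun j => A j)};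
    let dv : Fin n → ℕ → ((Fin n → ℕ) → κ) → ((Fin n → ℕ) → κ) := fun i s c B => c (Function.update B i (B i + s));
    let tr : Fin n → (Fin n → κ) → ℕ → ((Fin n → ℕ) → κ) → ((Fin n → ℕ) → κ) := fun i τ s c B => Finset.sum (Fintype.piFinset (fun _ : Fin n => Finset.range (B i + s + 1))) (fun D => @ite κ (D i = 0) (Classical.dec _) (c (B + D) * Finset.prod (Finset.univ.erase i) (fun j => ((Nat.choose (B j + D j) (B j) : ℕ) : κ) * τ j ^ (D j))) 0);
    let step : Fin n → (Fin n → κ) → ((Fin n → ℕ) → κ) → ((Fin n → ℕ) → κ) := fun i τ c => clean (tr i τ (@ite ℕ (p ≤ ord (clean c)) (Classical.dec _) p 0) (dv i (@ite ℕ (p ≤ ord (clean c)) (Classical.dec _) p 0) (bl i (clean c))));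
    let run : ((Fin n → ℕ) → κ) → (ℕ → Fin n) → (ℕ → Fin n → κ) → ℕ → ((Fin n → ℕ) → κ) := fun c₀ i t m => @Nat.rec (fun _ => (Fin n → ℕ) → κ) c₀ (fun m c => step (i m) (t m) c) m;
    let ser : ((Fin n → ℕ) → κ) → MvPowerSeries (Fin n) κ := fun c => show MvPowerSeries (Fin n) κ from fun A : Fin n →₀ ℕ => clean c ⇑A;
    let pd : Fin n → MvPowerSeries (Fin n) κ → MvPowerSeries (Fin n) κ := fun i f => show MvPowerSeries (Fin n) κ from fun A : Fin n →₀ ℕ => ((A i + 1 : ℕ) : κ) * f (A + Finsupp.single i 1);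
    let jac : ((Fin n → ℕ) → κ) → Ideal (MvPowerSeries (Fin n) κ) := fun c => Ideal.span (Set.range (fun i => pd i (ser c)));
    let Isol : ((Fin n → ℕ) → κ) → Prop := fun c => Module.Finite κ (MvPowerSeries (Fin n) κ ⧸ jac c);
    let sub : Fin n → (Fin n → κ) → MvPowerSeries (Fin n) κ → MvPowerSeries (Fin n) κ := fun i τ f => MvPowerSeries.subst (fun j : Fin n => @ite (MvPowerSeries (Fin n) κ) (j = i) (Classical.dec _) (MvPowerSeries.X i) (MvPowerSeries.X i * (MvPowerSeries.X j + MvPowerSeries.C (τ j)))) f;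
    let Phi : ℕ → MvPowerSeries (Fin n) κ → MvPowerSeries (Fin n) κ := fun m f => @Nat.rec (fun _ => MvPowerSeries (Fin n) κ) f (fun k g => sub (i k) (t k) g) m;
    let piE : ℕ → MvPowerSeries (Fin n) κ := fun m => @Nat.rec (fun _ => MvPowerSeries (Fin n) κ) 1 (fun k g => MvPowerSeries.X (i k) * sub (i k) (t k) g) m;
    Isol (run c₀ i t 0) →
    (∀ m, i (m + 1) = i m ∨ t (m + 1) (i m) ≠ 0) →
    (∀ (m : ℕ) (l : Fin n), ∃ h' : MvPowerSeries (Fin n) κ,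
        piE m * Phi m (pd l (ser (run c₀ i t 0))) = piE m ^ p * h') →
    False := by
  intro p hp n _ κ _ _ _ c₀ i t clean bl ord dv tr step run ser pd jac Isol sub Phi piE hIsol hfree hdiv
  exact endgame_main sub (fun _ _ _ => rfl) i t Phi piE p hp.two_le
    (fun l => pd l (ser (run c₀ i t 0))) (fun _ => rfl) (fun _ _ => rfl) rfl (fun _ => rfl)
    hIsol hfree hdiv

end Summit.ResolutionOfSingularities.ResolutionOfSingularities.Theorems.NarrowRunsDie

end
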